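import Literature.NumberTheory.Automorphic.IsomorphismGraphCentral
import Literature.NumberTheory.Automorphic.CentralizerTorusConnected
import Literature.NumberTheory.Automorphic.CentralizerLieAlgebra
import HarnessLib

/-!
# The graph group is a graph: `Lie(H) → Lie(G)` is injective and `H ∩ (1 × G') = 1`
(trunk T-AUTOMORPHIC, G25 AutomorphicL; step 8 of the graph proof of `chevalley_isomorphism_abstract`)

Sequel to `IsomorphismGraphCentral.lean`. For the graph group `H = T̃ · ⟨ũ_s, ṽ_s⟩ ≤ G × G'`
of two connected reductive groups with the same (reduced) root datum over an algebraically closed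
field of characteristic `0` (namespace `Literature.NumberTheory.Automorphic`):

* **`eq_zero_of_mem_lieAlgebraGL_graphGroup_of_toBlocks₁₁`** (and `…₂₂`) — **`Lie(H)` is a
  graph**: an element of `Lie(H)` with vanishing first (or second) block vanishes. `Lie(H)` is the
  sum of its `T̃`-weight spaces (Springer 7.1.1, `lieAlgebraGL_eq_iSup_lieWeightSpace`); the first
  blocks of the components lie in distinct `T`-weight spaces of `𝔤𝔩ₙ`, which are independent
  (`disjoint_weightSpaceGL_charOfWeight`), so each component has vanishing first block and is zero
  by the weight-wise statements (roots: `IsomorphismGraphLieRoots`; zero: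
  `IsomorphismGraphCentral`; other weights: `IsomorphismGraphLieGens`);
* **`identityComponent_inf_prodBlock_top_eq`** — `(H ∩ (T × GL_{n'}))° = T̃` (its Lie algebra is
  `Lie(T̃)` by the graph property and `Lie(T̃) ↠ Lie(T)`), and symmetrically
  `(H ∩ (GL_n × T'))° = T̃`;
* **`inf_centralizer_graphTorus_eq`** — `Z_H(T̃) = T̃` (`Z_H(T̃)` is connected, Springer 6.4.7 (i)
  `isZConnected_centralizer_torus_holds`, with Lie algebra `⊆ Lie(H)_0 = Lie(T̃)`);
* **`eq_one_of_inr_mem_graphGroup`** — **`(1, g') ∈ H` implies `g' = 1`**: the torus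
  `(1, g') T̃ (1, g')⁻¹ = {(t, g' f_T(t) g'⁻¹)}` is connected and lies in `H ∩ (T × GL_{n'})`,
  hence in its identity component `T̃`, so `g'` centralises `f_T(T) = T'`, so `g' ∈ T'`
  (Springer 7.6.4 (ii), `centralizer_eq_of_isMaximalTorusIn_holds`); then `(1, g')` centralises
  `T̃`, lies in `Z_H(T̃) = T̃`, and `T̃ ∩ (1 × G') = 1`. Symmetrically
  **`eq_one_of_inl_mem_graphGroup`**: `(g, 1) ∈ H` implies `g = 1`.

Everything is proved; no named fact is introduced (Humphreys, *Linear Algebraic Groups* §33, and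
Steinberg, *Lectures on Chevalley groups* §10, prove the corresponding statement through the
Bruhat decomposition; here the Lie algebra does the work).

## References

* [SpringerLAG1998] T. A. Springer, *Linear Algebraic Groups*, 2nd ed. (1998), 6.4.7, 7.1.1,
  7.6.4, Theorem 9.6.2.
* [Humphreys1975] J. E. Humphreys, *Linear Algebraic Groups*, GTM 21 (1975), §33.
-/

noncomputable section

open scoped MatrixGroups IsMulCommutative
open Matrix

namespace Literature.NumberTheory.Automorphic

variable {k : Type*} [Field k] {n n' : Type*} [Fintype n] [DecidableEq n] [Fintype n'] [DecidableEq n']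
variable {ι X Y : Type*} [AddCommGroup X] [AddCommGroup Y]
variable {G T : Subgroup (GL n k)} {G' T' : Subgroup (GL n' k)}
variable [IsMulCommutative ↥T] [IsMulCommutative ↥T']
variable {P : RootPairing ι ℤ X Y}
variable {eX : Additive ↥(characterLattice T) ≃+ X} {eY : Additive ↥(cocharacterLattice T) ≃+ Y}
variable {eX' : Additive ↥(characterLattice T') ≃+ X} {eY' : Additive ↥(cocharacterLattice T') ≃+ Y}

/-! ### Independence of the weight spaces of one torus -/

section OneGroup

variable {m : Type*} [Fintype m] [DecidableEq m] {T₀ : Subgroup (GL m k)}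

/-- **The weight spaces `(𝔤𝔩)_{χ_x}`, `x ∈ X`, of a torus are independent**: `(𝔤𝔩)_{χ_{x₀}}`
meets `⨆_{x ≠ x₀} (𝔤𝔩)_{χ_x}` trivially (`iSupIndep_adWeightSpace`, `x ↦ χ_x` injective).
[cite: SpringerLAG1998, 7.1.1] -/
theorem disjoint_weightSpaceGL_charOfWeight [IsAlgClosed k] (e₀ : Additive ↥(characterLattice T₀) ≃+ X)
    (hT₀ : IsTorusSubgroup T₀) (x₀ : X) :
    Disjoint (weightSpaceGL T₀ (charOfWeight e₀ x₀))
      (⨆ (x : X) (_ : x ≠ x₀), weightSpaceGL T₀ (charOfWeight e₀ x)) := by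
  haveI : IsMulCommutative ↥T₀ := hT₀.2.1
  let w : X → (↥T₀ → k) := fun x t => ((charOfWeight e₀ x t : kˣ) : k)
  have hw : Function.Injective w := by
    intro x y hxy
    apply charOfWeight_injective e₀
    ext t
    exact congrFun hxy t
  have hWe : ∀ x, weightSpaceGL T₀ (charOfWeight e₀ x) = adWeightSpace T₀ (w x) := fun x =>
    weightSpaceGL_eq_adWeightSpace _
  have hind := iSupIndep_adWeightSpace T₀ hT₀.2.2
  have hd := hind.disjoint_biSup (x := w x₀) (y := {f | f ≠ w x₀}) (by simp)
  rw [hWe]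
  refine hd.mono_right (iSup₂_le fun x hx => ?_)
  rw [hWe]
  exact le_biSup (fun f => adWeightSpace T₀ f) (hw.ne hx)

omit [Fintype m] [DecidableEq m] [AddCommGroup X] in
/-- **Components in independent subspaces**: if `∑_{i ∈ s} v_i = 0` with `v_i ∈ W_{x_i}` for an
injective labelling `x` and a family `W` with `W_{x₀} ∩ ⨆_{x ≠ x₀} W_x = 0`, then all `v_i = 0`.
[folklore] -/
theorem eq_zero_of_sum_eq_zero_of_disjoint {α M : Type*} [AddCommGroup M] [Module k M]
    (W : X → Submodule k M) (hW : ∀ x₀, Disjoint (W x₀) (⨆ (x : X) (_ : x ≠ x₀), W x))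
    {s : Finset α} {x : α → X} (hx : Function.Injective x) {v : α → M}
    (hv : ∀ i ∈ s, v i ∈ W (x i)) (hsum : ∑ i ∈ s, v i = 0) : ∀ i ∈ s, v i = 0 := by
  classical
  intro i₀ hi₀
  have hd := hW (x i₀)
  rw [Submodule.disjoint_def] at hd
  refine hd _ (hv i₀ hi₀) ?_
  have e : v i₀ = -∑ i ∈ s.erase i₀, v i := by
    rw [← Finset.add_sum_erase s v hi₀] at hsum
    exact eq_neg_of_add_eq_zero_left hsum
  rw [e]
  refine Submodule.neg_mem _ (Submodule.sum_mem _ fun i hi => ?_)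
  have hne : x i ≠ x i₀ := fun h => (Finset.mem_erase.1 hi).1 (hx h)
  exact Submodule.mem_iSup_of_mem (x i) (Submodule.mem_iSup_of_mem hne (hv i (Finset.mem_of_mem_erase hi)))

end OneGroup

omit [Fintype n] [Fintype n'] [DecidableEq n] [DecidableEq n'] in
/-- The first block of a finite sum. [folklore] -/
lemma toBlocks₁₁_sum {α : Type*} (s : Finset α) (g : α → Matrix (n ⊕ n') (n ⊕ n') k) :
    (∑ a ∈ s, g a).toBlocks₁₁ = ∑ a ∈ s, (g a).toBlocks₁₁ := by
  ext i j
  simp [Matrix.toBlocks₁₁, Matrix.sum_apply]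

omit [Fintype n] [Fintype n'] [DecidableEq n] [DecidableEq n'] in
/-- The second block of a finite sum. [folklore] -/
lemma toBlocks₂₂_sum {α : Type*} (s : Finset α) (g : α → Matrix (n ⊕ n') (n ⊕ n') k) :
    (∑ a ∈ s, g a).toBlocks₂₂ = ∑ a ∈ s, (g a).toBlocks₂₂ := by
  ext i j
  simp [Matrix.toBlocks₂₂, Matrix.sum_apply]

/-! ### `Lie(H)` is a graph -/

section Graph

variable [IsAlgClosed k] [CharZero k] (h : IsRootDatumOf G T P eX eY) (h' : IsRootDatumOf G' T' P eX' eY')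
  (b : P.Base) (hG : IsConnectedReductive G) (hTm : IsMaximalTorusIn T G)
  (hG' : IsConnectedReductive G') (hTm' : IsMaximalTorusIn T' G')

variable [Finite ι] [P.IsReduced]

include hG hG' in
/-- **Weight-wise graph property**: an element of `Lie(H)` of some `T̃`-weight `x` with a vanishing
block vanishes (roots: `eq_zero_of_mem_lieAlgebraGL_graphGroup_root_of_toBlocks`; `x = 0`:
`eq_zero_of_mem_lieAlgebraGL_graphGroup_zero_of_toBlocks₁₁/₂₂`; other weights:
`mem_lieAlgebraGL_graphGroup_weight_eq_zero`). [cite: SpringerLAG1998, 9.6.2] -/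
theorem eq_zero_of_mem_lieAlgebraGL_graphGroup_weight_of_toBlocks (x : X) {A : Matrix (n ⊕ n') (n ⊕ n') k}
    (hA : A ∈ lieAlgebraGL (graphGroup h h' hTm.2.1 hTm'.2.1 (b.support : Set ι)))
    (hw : A ∈ grW eX eX' hTm.2.1 hTm'.2.1 x) (h0 : A.toBlocks₁₁ = 0 ∨ A.toBlocks₂₂ = 0) : A = 0 := by
  by_cases hxr : x ∈ Set.range P.root
  · obtain ⟨j, rfl⟩ := hxr
    exact eq_zero_of_mem_lieAlgebraGL_graphGroup_root_of_toBlocks h h' b hG hTm hG' hTm' j hA hw h0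
  by_cases hx0 : x = 0
  · subst hx0
    rcases h0 with h0 | h0
    · exact eq_zero_of_mem_lieAlgebraGL_graphGroup_zero_of_toBlocks₁₁ h h' b hG hTm hG' hTm' hA hw h0
    · exact eq_zero_of_mem_lieAlgebraGL_graphGroup_zero_of_toBlocks₂₂ h h' b hG hTm hG' hTm' hA hw h0
  · exact mem_lieAlgebraGL_graphGroup_weight_eq_zero eX eX' h h' hG hTm hG' hTm' hx0 hxr hA hw

include hG hG' in
/-- **`Lie(H)` is a graph**: an element of `Lie(H)` with a vanishing first or second block
vanishes. Decompose along the `T̃`-weights (`lieAlgebraGL_eq_iSup_lieWeightSpace`); the vanishing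
block of `A` is the sum of the corresponding blocks of the components, which lie in distinct
weight spaces of `T` (resp. `T'`) and therefore all vanish (`eq_zero_of_sum_eq_zero_of_disjoint`);
conclude weight-wise. [cite: SpringerLAG1998, 9.6.2 with 7.1.1] -/
theorem eq_zero_of_mem_lieAlgebraGL_graphGroup_of_toBlocks {A : Matrix (n ⊕ n') (n ⊕ n') k}
    (hA : A ∈ lieAlgebraGL (graphGroup h h' hTm.2.1 hTm'.2.1 (b.support : Set ι)))
    (h0 : A.toBlocks₁₁ = 0 ∨ A.toBlocks₂₂ = 0) : A = 0 := by
  classical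
  set H := graphGroup h h' hTm.2.1 hTm'.2.1 (b.support : Set ι) with hH
  set TT := graphTorus eX eX' hTm.2.1 hTm'.2.1 with hTT
  have hTTt : IsTorusSubgroup TT := isTorusSubgroup_graphTorus eX eX' hTm.2.1 hTm'.2.1
  haveI : IsMulCommutative ↥TT := isMulCommutative_graphTorus eX eX' hTm.2.1 hTm'.2.1
  have hdec := lieAlgebraGL_eq_iSup_lieWeightSpace (G := H) TT
    (graphTorus_le_graphGroup h h' hTm.2.1 hTm'.2.1 (b.support : Set ι)) hTTt.2.2
  have hA' : A ∈ ⨆ χ : ↥(characterLattice TT), lieWeightSpace H TT χ := by rw [← hdec]; exact hA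
  obtain ⟨f, hf, hfA⟩ := (Submodule.mem_iSup_iff_exists_finsupp _ _).1 hA'
  -- the weights of the components
  choose xo hxo using fun χ : ↥(characterLattice TT) => exists_graphChar_eq eX eX' hTm.2.1 hTm'.2.1 χ.2
  have hxo_inj : Function.Injective xo := fun χ ψ e => Subtype.ext (by rw [← hxo χ, ← hxo ψ, e])
  have hcomp : ∀ χ, f χ ∈ lieAlgebraGL H ∧ f χ ∈ grW eX eX' hTm.2.1 hTm'.2.1 (xo χ) := fun χ =>
    ⟨(hf χ).1, by have hw := (hf χ).2; change f χ ∈ weightSpaceGL TT (graphChar _ _ _ _ (xo χ)); rw [hxo]; exact hw⟩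
  have hblk : ∀ χ, (f χ).toBlocks₁₁ ∈ weightSpaceGL T (charOfWeight eX (xo χ)) ∧
      (f χ).toBlocks₂₂ ∈ weightSpaceGL T' (charOfWeight eX' (xo χ)) := fun χ => by
    obtain ⟨-, h₁, h₂⟩ := mem_lieAlgebraGL_graphGroup_weight eX eX' hTm.2.1 hTm'.2.1 h h' (hcomp χ).1 (hcomp χ).2
    exact ⟨h₁.2, h₂.2⟩
  have hAsum : ∑ χ ∈ f.support, f χ = A := hfA
  -- all components have a vanishing block, hence vanish
  have hfz : ∀ χ ∈ f.support, f χ = 0 := by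
    rcases h0 with h0 | h0
    · have hsum : ∑ χ ∈ f.support, (f χ).toBlocks₁₁ = 0 := by rw [← toBlocks₁₁_sum, hAsum, h0]
      have hz := eq_zero_of_sum_eq_zero_of_disjoint (fun y => weightSpaceGL T (charOfWeight eX y))
        (disjoint_weightSpaceGL_charOfWeight eX hTm.2.1) hxo_inj (fun χ _ => (hblk χ).1) hsum
      exact fun χ hχ => eq_zero_of_mem_lieAlgebraGL_graphGroup_weight_of_toBlocks h h' b hG hTm hG' hTm' (xo χ)
        (hcomp χ).1 (hcomp χ).2 (Or.inl (hz χ hχ))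
    · have hsum : ∑ χ ∈ f.support, (f χ).toBlocks₂₂ = 0 := by rw [← toBlocks₂₂_sum, hAsum, h0]
      have hz := eq_zero_of_sum_eq_zero_of_disjoint (fun y => weightSpaceGL T' (charOfWeight eX' y))
        (disjoint_weightSpaceGL_charOfWeight eX' hTm'.2.1) hxo_inj (fun χ _ => (hblk χ).2) hsum
      exact fun χ hχ => eq_zero_of_mem_lieAlgebraGL_graphGroup_weight_of_toBlocks h h' b hG hTm hG' hTm' (xo χ)
        (hcomp χ).1 (hcomp χ).2 (Or.inr (hz χ hχ))
  rw [← hAsum]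
  exact Finset.sum_eq_zero hfz

/-! ### `(H ∩ (T × GL))° = T̃ = (H ∩ (GL × T'))°` and `Z_H(T̃) = T̃` -/

include hG hG' in
/-- `Lie(H ∩ (T × GL_{n'})) = Lie(T̃)`: the first block of `A ∈ Lie(H ∩ (T × GL))` lies in `Lie(T)`,
is the first block of some `B ∈ Lie(T̃)` (`exists_mem_lieAlgebraGL_graphTorus_toBlocks₁₁_eq`), and
`A - B ∈ Lie(H)` has vanishing first block. [cite: SpringerLAG1998, 9.6.2] -/
theorem lieAlgebraGL_inf_prodBlock_top_eq :
    lieAlgebraGL (graphGroup h h' hTm.2.1 hTm'.2.1 (b.support : Set ι) ⊓ prodBlock T (⊤ : Subgroup (GL n' k))) =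
      lieAlgebraGL (graphTorus eX eX' hTm.2.1 hTm'.2.1) := by
  refine le_antisymm (fun A hA => ?_) (lieAlgebraGL_mono (le_inf (graphTorus_le_graphGroup h h' _ _ _)
    ((graphTorus_le_prodBlock eX eX' _ _).trans (prodBlock_mono le_rfl le_top))))
  have hAH : A ∈ lieAlgebraGL (graphGroup h h' hTm.2.1 hTm'.2.1 (b.support : Set ι)) := lieAlgebraGL_mono inf_le_left hA
  obtain ⟨-, hz, -⟩ := eq_fromBlocks_of_mem_lieAlgebraGL_prodBlock (lieAlgebraGL_mono inf_le_right hA)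
  obtain ⟨B, hB, hB₁⟩ := exists_mem_lieAlgebraGL_graphTorus_toBlocks₁₁_eq eX eX' hTm.2.1 hTm'.2.1 hz
  have hBH : B ∈ lieAlgebraGL (graphGroup h h' hTm.2.1 hTm'.2.1 (b.support : Set ι)) :=
    lieAlgebraGL_mono (graphTorus_le_graphGroup h h' _ _ _) hB
  have hAB : A - B = 0 := by
    refine eq_zero_of_mem_lieAlgebraGL_graphGroup_of_toBlocks h h' b hG hTm hG' hTm' (Submodule.sub_mem _ hAH hBH) (Or.inl ?_)
    have e : (A - B).toBlocks₁₁ = A.toBlocks₁₁ - B.toBlocks₁₁ := by ext i j; rfl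
    rw [e, hB₁, sub_self]
  rw [sub_eq_zero.1 hAB]
  exact hB

include hG hG' in
/-- `Lie(H ∩ (GL_n × T')) = Lie(T̃)` (second-block version). [cite: SpringerLAG1998, 9.6.2] -/
theorem lieAlgebraGL_inf_prodBlock_top_eq' :
    lieAlgebraGL (graphGroup h h' hTm.2.1 hTm'.2.1 (b.support : Set ι) ⊓ prodBlock (⊤ : Subgroup (GL n k)) T') =
      lieAlgebraGL (graphTorus eX eX' hTm.2.1 hTm'.2.1) := by
  refine le_antisymm (fun A hA => ?_) (lieAlgebraGL_mono (le_inf (graphTorus_le_graphGroup h h' _ _ _)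
    ((graphTorus_le_prodBlock eX eX' _ _).trans (prodBlock_mono le_top le_rfl))))
  have hAH : A ∈ lieAlgebraGL (graphGroup h h' hTm.2.1 hTm'.2.1 (b.support : Set ι)) := lieAlgebraGL_mono inf_le_left hA
  obtain ⟨-, -, hz'⟩ := eq_fromBlocks_of_mem_lieAlgebraGL_prodBlock (lieAlgebraGL_mono inf_le_right hA)
  obtain ⟨B, hB, hB₂⟩ := exists_mem_lieAlgebraGL_graphTorus_toBlocks₂₂_eq eX eX' hTm.2.1 hTm'.2.1 hz'
  have hBH : B ∈ lieAlgebraGL (graphGroup h h' hTm.2.1 hTm'.2.1 (b.support : Set ι)) :=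
    lieAlgebraGL_mono (graphTorus_le_graphGroup h h' _ _ _) hB
  have hAB : A - B = 0 := by
    refine eq_zero_of_mem_lieAlgebraGL_graphGroup_of_toBlocks h h' b hG hTm hG' hTm' (Submodule.sub_mem _ hAH hBH) (Or.inr ?_)
    have e : (A - B).toBlocks₂₂ = A.toBlocks₂₂ - B.toBlocks₂₂ := by ext i j; rfl
    rw [e, hB₂, sub_self]
  rw [sub_eq_zero.1 hAB]
  exact hB

include hG hG' in
/-- **`(H ∩ (T × GL_{n'}))° = T̃`** (both are connected with the same Lie algebra,
`IsZConnected.eq_of_le_of_lieAlgebraGL_eq`). [cite: SpringerLAG1998, 9.6.2] -/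
theorem identityComponent_inf_prodBlock_top_eq :
    identityComponent (graphGroup h h' hTm.2.1 hTm'.2.1 (b.support : Set ι) ⊓ prodBlock T (⊤ : Subgroup (GL n' k))) =
      graphTorus eX eX' hTm.2.1 hTm'.2.1 := by
  have hMalg : IsAlgebraicSubgroup (graphGroup h h' hTm.2.1 hTm'.2.1 (b.support : Set ι) ⊓ prodBlock T (⊤ : Subgroup (GL n' k))) :=
    (isAlgebraicSubgroup_graphGroup h h' _ _ _).inf (isAlgebraicSubgroup_prodBlock hTm.2.1.1.1 isAlgebraicSubgroup_top)
  have hle : graphTorus eX eX' hTm.2.1 hTm'.2.1 ≤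
      graphGroup h h' hTm.2.1 hTm'.2.1 (b.support : Set ι) ⊓ prodBlock T (⊤ : Subgroup (GL n' k)) :=
    le_inf (graphTorus_le_graphGroup h h' _ _ _) ((graphTorus_le_prodBlock eX eX' _ _).trans (prodBlock_mono le_rfl le_top))
  refine ((isZConnected_graphTorus eX eX' hTm.2.1 hTm'.2.1).eq_of_le_of_lieAlgebraGL_eq (isZConnected_identityComponent hMalg)
    ((isZConnected_graphTorus eX eX' hTm.2.1 hTm'.2.1).le_identityComponent_of_le hle) ?_).symm
  rw [lieAlgebraGL_identityComponent hMalg, lieAlgebraGL_inf_prodBlock_top_eq h h' b hG hTm hG' hTm']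

include hG hG' in
/-- **`(H ∩ (GL_n × T'))° = T̃`.** [cite: SpringerLAG1998, 9.6.2] -/
theorem identityComponent_inf_prodBlock_top_eq' :
    identityComponent (graphGroup h h' hTm.2.1 hTm'.2.1 (b.support : Set ι) ⊓ prodBlock (⊤ : Subgroup (GL n k)) T') =
      graphTorus eX eX' hTm.2.1 hTm'.2.1 := by
  have hMalg : IsAlgebraicSubgroup (graphGroup h h' hTm.2.1 hTm'.2.1 (b.support : Set ι) ⊓ prodBlock (⊤ : Subgroup (GL n k)) T') :=
    (isAlgebraicSubgroup_graphGroup h h' _ _ _).inf (isAlgebraicSubgroup_prodBlock isAlgebraicSubgroup_top hTm'.2.1.1.1)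
  have hle : graphTorus eX eX' hTm.2.1 hTm'.2.1 ≤
      graphGroup h h' hTm.2.1 hTm'.2.1 (b.support : Set ι) ⊓ prodBlock (⊤ : Subgroup (GL n k)) T' :=
    le_inf (graphTorus_le_graphGroup h h' _ _ _) ((graphTorus_le_prodBlock eX eX' _ _).trans (prodBlock_mono le_top le_rfl))
  refine ((isZConnected_graphTorus eX eX' hTm.2.1 hTm'.2.1).eq_of_le_of_lieAlgebraGL_eq (isZConnected_identityComponent hMalg)
    ((isZConnected_graphTorus eX eX' hTm.2.1 hTm'.2.1).le_identityComponent_of_le hle) ?_).symm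
  rw [lieAlgebraGL_identityComponent hMalg, lieAlgebraGL_inf_prodBlock_top_eq' h h' b hG hTm hG' hTm']

include hG hG' in
/-- **`Z_H(T̃) = T̃`**: `Z_H(T̃)` is connected (Springer 6.4.7 (i), `isZConnected_centralizer_torus_holds`)
and its Lie algebra lies in `Lie(H)_0 = Lie(T̃)` (`lieAlgebraGL_centralizer_le_lieWeightSpace_one`,
`mem_lieAlgebraGL_graphTorus_of_mem_zero`). [cite: SpringerLAG1998, 6.4.7 (i) and 9.6.2] -/
theorem inf_centralizer_graphTorus_eq :
    graphGroup h h' hTm.2.1 hTm'.2.1 (b.support : Set ι) ⊓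
        Subgroup.centralizer (graphTorus eX eX' hTm.2.1 hTm'.2.1 : Set (GL (n ⊕ n') k)) =
      graphTorus eX eX' hTm.2.1 hTm'.2.1 := by
  set H := graphGroup h h' hTm.2.1 hTm'.2.1 (b.support : Set ι) with hH
  set TT := graphTorus eX eX' hTm.2.1 hTm'.2.1 with hTT
  haveI : IsMulCommutative ↥TT := isMulCommutative_graphTorus eX eX' hTm.2.1 hTm'.2.1
  have hZ : IsZConnected (H ⊓ Subgroup.centralizer (TT : Set (GL (n ⊕ n') k))) :=
    isZConnected_centralizer_torus_holds (isZConnected_graphGroup h h' _ _ _) (graphTorus_le_graphGroup h h' _ _ _)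
      (isTorusSubgroup_graphTorus eX eX' _ _)
  have hle : TT ≤ H ⊓ Subgroup.centralizer (TT : Set (GL (n ⊕ n') k)) :=
    le_inf (graphTorus_le_graphGroup h h' _ _ _) fun t ht =>
      Subgroup.mem_centralizer_iff.2 fun s hs => congrArg Subtype.val (mul_comm (⟨s, hs⟩ : ↥TT) ⟨t, ht⟩)
  refine ((isZConnected_graphTorus eX eX' hTm.2.1 hTm'.2.1).eq_of_le_of_lieAlgebraGL_eq hZ hle
    (le_antisymm (lieAlgebraGL_mono hle) fun A hA => ?_)).symm
  have hA' := lieAlgebraGL_centralizer_le_lieWeightSpace_one H TT hA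
  have hAH : A ∈ lieAlgebraGL H := hA'.1
  have hw : A ∈ grW eX eX' hTm.2.1 hTm'.2.1 0 := by
    change A ∈ weightSpaceGL TT (graphChar eX eX' _ _ 0)
    rw [graphChar_zero]
    exact hA'.2
  exact mem_lieAlgebraGL_graphTorus_of_mem_zero h h' b hG hTm hG' hTm' hAH hw

/-! ### The kernels of the two projections are trivial -/

include hG hG' in
/-- **`(1, g') ∈ H` implies `g' = 1`.** The conjugate torus `{(t, g' f_T(t) g'⁻¹)}` of `T̃` by
`(1, g')` is connected and contained in `H ∩ (T × GL)`, hence in `(H ∩ (T × GL))° = T̃`; so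
`g' f_T(t) g'⁻¹ = f_T(t)` for all `t`, `g'` centralises `T'` and lies in `T'` (Springer 7.6.4 (ii));
then `(1, g') ∈ Z_H(T̃) = T̃`, whose only element with first block `1` is `1`.
[cite: SpringerLAG1998, 9.6.2] -/
theorem eq_one_of_inr_mem_graphGroup {g' : GL n' k}
    (hg : blockDiagGL ((1 : GL n k), g') ∈ graphGroup h h' hTm.2.1 hTm'.2.1 (b.support : Set ι)) : g' = 1 := by
  set H := graphGroup h h' hTm.2.1 hTm'.2.1 (b.support : Set ι) with hH
  set TT := graphTorus eX eX' hTm.2.1 hTm'.2.1 with hTT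
  set κ : GL (n ⊕ n') k := blockDiagGL ((1 : GL n k), g') with hκ
  have hg'G : g' ∈ G' := (blockDiagGL_mem_prodBlock_iff.1 (graphGroup_le_prodBlock h h' _ _ _ hg)).2
  -- the conjugate torus lies in `(H ∩ (T × GL))° = T̃`
  have hconj : ∀ t : ↥T, κ * graphTorusHom eX eX' hTm.2.1 hTm'.2.1 t * κ⁻¹ =
      blockDiagGL ((t : GL n k), g' * ((torusIsoOfWeights eX eX' hTm.2.1 hTm'.2.1 t : ↥T') : GL n' k) * g'⁻¹) := by
    intro t
    rw [graphTorusHom_apply, hκ, ← map_inv, ← map_mul, ← map_mul]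
    congr 1
    refine Prod.ext (by simp) (by simp)
  have hSle : TT.map (MulAut.conj κ : GL (n ⊕ n') k →* GL (n ⊕ n') k) ≤ H ⊓ prodBlock T (⊤ : Subgroup (GL n' k)) := by
    rintro _ ⟨s, ⟨t, rfl⟩, rfl⟩
    change κ * graphTorusHom eX eX' hTm.2.1 hTm'.2.1 t * κ⁻¹ ∈ _
    refine ⟨H.mul_mem (H.mul_mem hg (graphTorusHom_mem_graphGroup h h' _ _ _ t)) (H.inv_mem hg), ?_⟩
    rw [hconj]
    exact blockDiagGL_mem_prodBlock t.2 (Subgroup.mem_top _)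
  have hSTT : TT.map (MulAut.conj κ : GL (n ⊕ n') k →* GL (n ⊕ n') k) ≤ TT := by
    have := ((isZConnected_graphTorus eX eX' hTm.2.1 hTm'.2.1).map_conj κ).le_identityComponent_of_le hSle
    rwa [identityComponent_inf_prodBlock_top_eq h h' b hG hTm hG' hTm'] at this
  -- hence `g'` centralises `T'`
  have hcent : ∀ t' : ↥T', g' * (t' : GL n' k) * g'⁻¹ = t' := by
    intro t'
    set t : ↥T := (torusIsoOfWeights eX eX' hTm.2.1 hTm'.2.1).symm t' with ht
    have ht' : torusIsoOfWeights eX eX' hTm.2.1 hTm'.2.1 t = t' := by rw [ht, MulEquiv.apply_symm_apply]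
    have hmem : κ * graphTorusHom eX eX' hTm.2.1 hTm'.2.1 t * κ⁻¹ ∈ TT :=
      hSTT ⟨graphTorusHom eX eX' _ _ t, graphTorusHom_mem eX eX' _ _ t, rfl⟩
    obtain ⟨s, hs⟩ := hmem
    rw [hconj, graphTorusHom_apply] at hs
    have e := Prod.ext_iff.1 (blockDiagGL_injective hs)
    have e1 : s = t := Subtype.ext (by simpa using e.1)
    subst e1
    have e2 := e.2
    simp only at e2
    rw [ht'] at e2
    exact e2.symm
  have hg'T : g' ∈ T' := by
    have hmem : g' ∈ G' ⊓ Subgroup.centralizer (T' : Set (GL n' k)) :=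
      ⟨hg'G, Subgroup.mem_centralizer_iff.2 fun t' ht' => by
        have e := hcent ⟨t', ht'⟩
        simp only at e
        calc t' * g' = g' * t' * g'⁻¹ * g' := by rw [e]
          _ = g' * t' := by rw [inv_mul_cancel_right]⟩
    rwa [centralizer_eq_of_isMaximalTorusIn_holds hG' hTm'] at hmem
  -- `κ` centralises `T̃`, hence lies in `Z_H(T̃) = T̃`
  have hκZ : κ ∈ H ⊓ Subgroup.centralizer (TT : Set (GL (n ⊕ n') k)) := by
    refine ⟨hg, Subgroup.mem_centralizer_iff.2 ?_⟩
    rintro _ ⟨t, rfl⟩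
    rw [graphTorusHom_apply, hκ, ← map_mul, ← map_mul]
    congr 1
    refine Prod.ext (by simp) ?_
    simp only [Prod.snd_mul]
    exact congrArg Subtype.val (mul_comm (torusIsoOfWeights eX eX' hTm.2.1 hTm'.2.1 t) ⟨g', hg'T⟩)
  rw [inf_centralizer_graphTorus_eq h h' b hG hTm hG' hTm'] at hκZ
  obtain ⟨s, hs⟩ := hκZ
  rw [graphTorusHom_apply, hκ] at hs
  have e := Prod.ext_iff.1 (blockDiagGL_injective hs)
  have e1 : s = 1 := Subtype.ext (by simpa using e.1)
  subst e1
  have e2 := e.2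
  simp only [map_one, OneMemClass.coe_one] at e2
  exact e2.symm

include hG hG' in
/-- **`(g, 1) ∈ H` implies `g = 1`** (the symmetric statement, through `(H ∩ (GL × T'))° = T̃`,
`Z_G(T) = T` and `Z_H(T̃) = T̃`). [cite: SpringerLAG1998, 9.6.2] -/
theorem eq_one_of_inl_mem_graphGroup {g : GL n k}
    (hg : blockDiagGL (g, (1 : GL n' k)) ∈ graphGroup h h' hTm.2.1 hTm'.2.1 (b.support : Set ι)) : g = 1 := by
  set H := graphGroup h h' hTm.2.1 hTm'.2.1 (b.support : Set ι) with hH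
  set TT := graphTorus eX eX' hTm.2.1 hTm'.2.1 with hTT
  set κ : GL (n ⊕ n') k := blockDiagGL (g, (1 : GL n' k)) with hκ
  have hgG : g ∈ G := (blockDiagGL_mem_prodBlock_iff.1 (graphGroup_le_prodBlock h h' _ _ _ hg)).1
  have hconj : ∀ t : ↥T, κ * graphTorusHom eX eX' hTm.2.1 hTm'.2.1 t * κ⁻¹ =
      blockDiagGL (g * (t : GL n k) * g⁻¹, ((torusIsoOfWeights eX eX' hTm.2.1 hTm'.2.1 t : ↥T') : GL n' k)) := by
    intro t
    rw [graphTorusHom_apply, hκ, ← map_inv, ← map_mul, ← map_mul]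
    congr 1
    refine Prod.ext (by simp) (by simp)
  have hSle : TT.map (MulAut.conj κ : GL (n ⊕ n') k →* GL (n ⊕ n') k) ≤ H ⊓ prodBlock (⊤ : Subgroup (GL n k)) T' := by
    rintro _ ⟨s, ⟨t, rfl⟩, rfl⟩
    change κ * graphTorusHom eX eX' hTm.2.1 hTm'.2.1 t * κ⁻¹ ∈ _
    refine ⟨H.mul_mem (H.mul_mem hg (graphTorusHom_mem_graphGroup h h' _ _ _ t)) (H.inv_mem hg), ?_⟩
    rw [hconj]
    exact blockDiagGL_mem_prodBlock (Subgroup.mem_top _) (torusIsoOfWeights eX eX' _ _ t).2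
  have hSTT : TT.map (MulAut.conj κ : GL (n ⊕ n') k →* GL (n ⊕ n') k) ≤ TT := by
    have := ((isZConnected_graphTorus eX eX' hTm.2.1 hTm'.2.1).map_conj κ).le_identityComponent_of_le hSle
    rwa [identityComponent_inf_prodBlock_top_eq' h h' b hG hTm hG' hTm'] at this
  -- hence `g` centralises `T`
  have hcent : ∀ t : ↥T, g * (t : GL n k) * g⁻¹ = t := by
    intro t
    have hmem : κ * graphTorusHom eX eX' hTm.2.1 hTm'.2.1 t * κ⁻¹ ∈ TT :=
      hSTT ⟨graphTorusHom eX eX' _ _ t, graphTorusHom_mem eX eX' _ _ t, rfl⟩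
    obtain ⟨s, hs⟩ := hmem
    rw [hconj, graphTorusHom_apply] at hs
    have e := Prod.ext_iff.1 (blockDiagGL_injective hs)
    have e2 : s = t := (torusIsoOfWeights eX eX' hTm.2.1 hTm'.2.1).injective (Subtype.ext (by simpa using e.2))
    subst e2
    simpa using e.1.symm
  have hgT : g ∈ T := by
    have hmem : g ∈ G ⊓ Subgroup.centralizer (T : Set (GL n k)) :=
      ⟨hgG, Subgroup.mem_centralizer_iff.2 fun t ht => by
        have e := hcent ⟨t, ht⟩
        simp only at e
        calc t * g = g * t * g⁻¹ * g := by rw [e]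
          _ = g * t := by rw [inv_mul_cancel_right]⟩
    rwa [centralizer_eq_of_isMaximalTorusIn_holds hG hTm] at hmem
  have hκZ : κ ∈ H ⊓ Subgroup.centralizer (TT : Set (GL (n ⊕ n') k)) := by
    refine ⟨hg, Subgroup.mem_centralizer_iff.2 ?_⟩
    rintro _ ⟨t, rfl⟩
    rw [graphTorusHom_apply, hκ, ← map_mul, ← map_mul]
    congr 1
    refine Prod.ext ?_ (by simp)
    simp only [Prod.fst_mul]
    exact congrArg Subtype.val (mul_comm t ⟨g, hgT⟩)
  rw [inf_centralizer_graphTorus_eq h h' b hG hTm hG' hTm'] at hκZ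
  obtain ⟨s, hs⟩ := hκZ
  rw [graphTorusHom_apply, hκ] at hs
  have e := Prod.ext_iff.1 (blockDiagGL_injective hs)
  have e2 : s = 1 := (torusIsoOfWeights eX eX' hTm.2.1 hTm'.2.1).injective (Subtype.ext (by simpa using e.2))
  subst e2
  simpa using e.1.symm

end Graph

end Literature.NumberTheory.Automorphic

end
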